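import Mathlib
import HarnessLib
import Summits.NavierStokesRegularity.NavierStokesRegularity.Theorems.PoloidalWindowDoorPoloidalWindowRigidityStructureFunctionNormalForm
import Summits.NavierStokesRegularity.NavierStokesRegularity.Theorems.PoloidalWindowDoorLrcModEntireStructureFunctionT0

/-!
# Route `PoloidalWindowDoor`, crux `PoloidalWindowRigidity` (K2, stmt-NavierStokesRegularity-19708), skeleton `lrc-jet` v5,
# stub `stub_untwisted` — brick F2c: THE STRUCTURE-FUNCTION NORMAL FORM OF AN UNTWISTED NON-DEGENERATE CLASS GERM, PACKAGED

Cell ns-regularity-ideate, seat ns-poloidal-K2-p2 (gen 5; stub-worker under the K2 lead ns-poloidal-K2-p1 g6; `--supports stmt-NavierStokesRegularity-19708`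
helper; brick F2 of `BRIEF-v5-bricks-v2.md` (S5); paper source `Cruxes/PoloidalWindowRigidity/UNTWISTED-NOTE.md` §1–§3).  Third file of F2, after
`…StructureFunctionDynamics` (F2a: the dynamic scalar `T` is leafwise; chain rules) and `…StructureFunctionNormalForm` (F2b: (K1), (Sz), (V0) pointwise).

* `contDiffAt_dirPartial`, `contDiffAt_dotPartial` — `Cⁿ` bookkeeping for partials / the vertical-line derivative `Ṗ = DP(P,1)` of structure functions.
* `shear_eq_slope_mul` — for the Clebsch pair of a slice and a point where `Dψ = F_w·Dv₂ + F_z·dy₂`: `∂₂v_b = (1 − F_w)·∂_bv₂` (`b = 0,1`).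
* `untwisted_normalForm` — **THE PACKAGE.**  From EXACTLY the data of `stub_untwisted` (class profile, poloidal along `e₃`, an open `W` of the slab on
  which the profile is non-degenerate and the twist bracket `{∂₂v₂, v₂}ₕ` vanishes) and a point `(t, y₀) ∈ W`, for every finite order `n`: an open `U ∋ y₀`
  of the slice `t` inside `W` and functions `P, Λ, c, k, pₜ : ℝ × ℝ → ℝ` of `(w, y₂)` (`w = v₂(t,·)`), all `Cⁿ` at the leaf points `(w y, y₂)`, `y ∈ U`, with
  `Λ ∉ {0,1}` there, such that on `U`: `∂₂w = P(w,y₂)` (hP), `∂₂v_b = Λ(w,y₂)∂_bw` (hΛ), `Λ·M + Λ_w·E + c = 0` (hK1), `(1−Λ)·S = (1−Λ)·M − Λ_w·E + k`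
  (hV0), `∂₂S = P_w·S + Λ·E + pₜ` (hSz) — `E = (∂₀w)² + (∂₁w)²`, `M = ∂₀∂₀w + ∂₁∂₁w`, `S = v₀∂₀w + v₁∂₁w + ∂ₜw` — i.e. the hypotheses of the
  lead's `…UntwistedSeparation{,2}` (F3a/F3b) and `…UntwistedStuartTranslation` (F4) at one slice.  Ingredients: K2-p3's structure function
  `ψ = F̃(τ, v₂, y₂)` (`Λ = 1 − ∂_wF̃(t,·,·)`), the untwisted `∂₂v₂ = P̃(τ, v₂, y₂)` (`exists_comp_spaceTime` on the twist bracket, `P = P̃(t,·,·)`, `c = Ṗ`,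
  `pₜ = ∂ₜP̃(t,·,·)`), the leafwise dynamic scalar `T = τ(v₂, y₂)` of F2a (`k = τ −` explicit jets), and F2b's three pointwise identities.

WHAT THIS IS NOT: not a claim about Navier–Stokes regularity and not the stub — its analytic normal form (bears_on LADDER-NS N0 via crux K2 = stmt-19708).
-/

noncomputable section

-- the summit and its single sub-problem share the name (CONVENTIONS §1), as in every Theorems file
set_option linter.dupNamespace false

namespace Summit.NavierStokesRegularity.NavierStokesRegularity.Theorems.PoloidalWindowDoorPoloidalWindowRigidityUntwistedDynamics

open Set Function Filter Topology Metric
open scoped RealInnerProductSpace InnerProductSpace Laplacian ContDiff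
open Literature.Analysis Literature.Analysis.FluidPDE Literature.Analysis.Calculus
open Summit.NavierStokesRegularity.NavierStokesRegularity.Theorems.LocalSineTubeDoorProfileAlignedWindowRigidityAncient
open Summit.NavierStokesRegularity.NavierStokesRegularity.Theorems.PoloidalWindowDoorPoloidalWindowRigidityClebsch
open Summit.NavierStokesRegularity.NavierStokesRegularity.Theorems.PoloidalWindowDoorPoloidalWindowRigidityStructureFunction
open Summit.NavierStokesRegularity.NavierStokesRegularity.Theorems.PoloidalWindowDoorPoloidalWindowRigidityStructureFunctionSlope
open Summit.NavierStokesRegularity.NavierStokesRegularity.Theorems.PoloidalWindowDoorLrcModEntireStructureFunctionT0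
open Summit.NavierStokesRegularity.NavierStokesRegularity.Theorems.PoloidalWindowDoorPoloidalWindowRigidityConstantShearMeans
open Summit.NavierStokesRegularity.NavierStokesRegularity.Theorems.PoloidalWindowDoorPoloidalWindowRigidityUntwistedKinematics
open Summit.NavierStokesRegularity.NavierStokesRegularity.Theorems.PoloidalWindowDoorPoloidalWindowRigidityStructureFunctionDynamics
open Summit.NavierStokesRegularity.NavierStokesRegularity.Theorems.PoloidalWindowDoorPoloidalWindowRigidityStructureFunctionNormalForm

/-! ### Regularity bookkeeping for structure functions on `ℝ × ℝ` -/

/-- A directional partial of a `C^{m+1}` function on `ℝ × ℝ` is `C^m` (finite orders). [folklore] -/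
theorem contDiffAt_dirPartial {G : ℝ × ℝ → ℝ} {p : ℝ × ℝ} {m : ℕ} (hG : ContDiffAt ℝ ((m + 1 : ℕ) : WithTop ℕ∞) G p) (u : ℝ × ℝ) :
    ContDiffAt ℝ (m : WithTop ℕ∞) (fun q => fderiv ℝ G q u) p := by
  have h1 : ContDiffAt ℝ (m : WithTop ℕ∞) (fderiv ℝ G) p := hG.fderiv_right (m := m) (by push_cast; exact le_rfl)
  exact h1.clm_apply contDiffAt_const

/-- The vertical-line derivative `q ↦ DP(q)(P q, 1)` of a `C^{m+1}` structure function is `C^m`. [folklore] -/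
theorem contDiffAt_dotPartial {P : ℝ × ℝ → ℝ} {p : ℝ × ℝ} {m : ℕ} (hP : ContDiffAt ℝ ((m + 1 : ℕ) : WithTop ℕ∞) P p) :
    ContDiffAt ℝ (m : WithTop ℕ∞) (fun q => fderiv ℝ P q (P q, 1)) p := by
  have h1 : ContDiffAt ℝ (m : WithTop ℕ∞) (fderiv ℝ P) p := hP.fderiv_right (m := m) (by push_cast; exact le_rfl)
  have h2 : ContDiffAt ℝ (m : WithTop ℕ∞) (fun q => ((P q, (1 : ℝ)) : ℝ × ℝ)) p :=
    (hP.of_le (by exact_mod_cast Nat.le_succ m)).prodMk contDiffAt_const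
  exact h1.clm_apply h2

section Profile

variable {C : ℝ} {v : ℝ → EuclideanSpace ℝ (Fin 3) → EuclideanSpace ℝ (Fin 3)}

/-- **The shear slope is `1 − F_w`.**  For the Clebsch pair of a slice (`∂_bφ = v_b`, `v₂ = ∂₂φ + ψ`, `φ ∈ C²`, `v` differentiable) and a point
where `D(ψ)(y) = F_w·D(v₂)(y) + F_z·dy₂`:  `∂₂v_b(y) = (1 − F_w)·∂_b v₂(y)` for `b = 0,1` (`∂₂v_b = ∂_b(v₂ − ψ)`, K2-p3's
`fderiv_q_eq_fderiv_vertical`). [folklore] -/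
theorem shear_eq_slope_mul {φ ψ : EuclideanSpace ℝ (Fin 3) → ℝ} {V : EuclideanSpace ℝ (Fin 3) → EuclideanSpace ℝ (Fin 3)}
    (hφ : ContDiff ℝ 2 φ) (hψ : Differentiable ℝ ψ) (hV : Differentiable ℝ V)
    (h0 : ∀ y, fderiv ℝ φ y (EuclideanSpace.single 0 1) = V y 0) (h1 : ∀ y, fderiv ℝ φ y (EuclideanSpace.single 1 1) = V y 1)
    (h2 : ∀ y, V y 2 = fderiv ℝ φ y (EuclideanSpace.single 2 1) + ψ y) {y : EuclideanSpace ℝ (Fin 3)} {Fw Fz : ℝ}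
    (hDx : ∀ e : EuclideanSpace ℝ (Fin 3), fderiv ℝ ψ y e = Fw * fderiv ℝ (fun x => V x 2) y e + e 2 * Fz)
    {b : Fin 3} (hb : b ≠ 2) :
    fderiv ℝ V y (EuclideanSpace.single 2 1) b = (1 - Fw) * fderiv ℝ (fun x => V x 2) y (EuclideanSpace.single b (1 : ℝ)) := by
  have hb' : ∀ y, fderiv ℝ φ y (EuclideanSpace.single b 1) = V y b := by
    have hcases : b = 0 ∨ b = 1 := by
      revert hb; revert b; decide
    rcases hcases with rfl | rfl
    · exact h0
    · exact h1
  rw [← fderiv_q_eq_fderiv_vertical hφ hV hb' h2 y]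
  have hw : DifferentiableAt ℝ (fun x => V x 2) y := by
    have := ((EuclideanSpace.proj (𝕜 := ℝ) (2 : Fin 3)).differentiableAt).comp y (hV y)
    simpa [Function.comp_def] using this
  rw [fderiv_fun_sub hw (hψ y)]
  simp only [_root_.sub_apply]
  rw [hDx]
  have e2 : (EuclideanSpace.single b (1 : ℝ) : EuclideanSpace ℝ (Fin 3)) 2 = 0 := by simp [hb.symm]
  rw [e2]
  ring


/-- **BRICK F2 — THE STRUCTURE-FUNCTION NORMAL FORM OF AN UNTWISTED NON-DEGENERATE CLASS GERM, PACKAGED.**  Let `v` be a profile of the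
route's Type-I class (Type-I time rate, continuous on the slab, unit-viscosity Oseen-mild, divergence-free slices), poloidal along `e₃`, and let
`W` be an open subset of the backward slab on which the profile is NON-DEGENERATE (`curl v ≠ 0`, `∇ₕv₂ ≠ 0`, `∂₂vₕ ≠ 0`) and UNTWISTED (the
twist bracket `{∂₂v₂, v₂}ₕ` vanishes) — exactly the data of the registered stub `stub_untwisted`.  Then for every `(t, y₀) ∈ W` and every finite
order `n` there are an open set `U ∋ y₀` of the slice `t` inside `W` and five functions `P, Λ, c, k, pₜ : ℝ × ℝ → ℝ` of `(w, y₂)`, all of class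
`Cⁿ` at the leaf points `(w y, y₂)`, `y ∈ U` (`w := v₂(t,·)`), with `Λ ∉ {0, 1}` there, such that on `U`, writing `E = (∂₀w)² + (∂₁w)²`,
`M = ∂₀∂₀w + ∂₁∂₁w`, `S = v₀∂₀w + v₁∂₁w + ∂ₜw`:
`hP`  `∂₂w = P(w,y₂)`;  `hΛ`  `∂₂v_b = Λ(w,y₂)·∂_bw` (`b = 0,1`);  `hK1`  `Λ·M + Λ_w·E + c = 0`;
`hV0` `(1−Λ)·S = (1−Λ)·M − Λ_w·E + k`;  `hSz` `∂₂S = P_w·S + Λ·E + pₜ`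
— the hypotheses of the K2 lead's `…UntwistedSeparation{,2}` (bricks F3a/F3b) and `…UntwistedStuartTranslation` (F4), UNTWISTED-NOTE §1/§3.
(`P, Λ` are slices of SPACE–TIME structure functions: `P = P̃(t,·,·)` from the twist bracket by `exists_comp_spaceTime`, `Λ = 1 − ∂_wF̃(t,·,·)` from
K2-p3's `exists_clebsch_eq_structureFunction`; `c = Ṗ`, `pₜ = ∂ₜP̃(t,·,·)`, `k` = the leafwise dynamic scalar `τ` of `exists_dynScalar_eq_leafwise` minus
explicit jets.) -/
theorem untwisted_normalForm (n : ℕ) (hrate : HasTypeITimeDecay C v)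
    (hcont : ContinuousOn (uncurry v) (Iio (0 : ℝ) ×ˢ univ))
    (hmild : ∀ s t : ℝ, s < t → t < 0 → ∀ x,
      v t x = UnboundedOperators.heatExtension (v s) (t - s) x - oseenDuhamel 1 s v v t x)
    (hdiv : ∀ t < 0, VectorCalculus.IsDivFree (v t))
    (hpol : ∀ s < 0, ∀ y, ⟪curl (v s) y, EuclideanSpace.single 2 1⟫_ℝ = 0)
    {W : Set (ℝ × EuclideanSpace ℝ (Fin 3))} (hW : IsOpen W) (hWs : W ⊆ Iio (0 : ℝ) ×ˢ univ)
    (hND : ∀ z ∈ W, curl (v z.1) z.2 ≠ 0 ∧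
      (fderiv ℝ (v z.1) z.2 (EuclideanSpace.single 0 1) 2 ≠ 0 ∨ fderiv ℝ (v z.1) z.2 (EuclideanSpace.single 1 1) 2 ≠ 0) ∧
      (fderiv ℝ (v z.1) z.2 (EuclideanSpace.single 2 1) 0 ≠ 0 ∨ fderiv ℝ (v z.1) z.2 (EuclideanSpace.single 2 1) 1 ≠ 0))
    (htw : ∀ z ∈ W,
      fderiv ℝ (fun x => fderiv ℝ (v z.1) x (EuclideanSpace.single 2 1) 2) z.2 (EuclideanSpace.single 0 1) *
          fderiv ℝ (v z.1) z.2 (EuclideanSpace.single 1 1) 2 -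
        fderiv ℝ (fun x => fderiv ℝ (v z.1) x (EuclideanSpace.single 2 1) 2) z.2 (EuclideanSpace.single 1 1) *
          fderiv ℝ (v z.1) z.2 (EuclideanSpace.single 0 1) 2 = 0)
    {t : ℝ} {y₀ : EuclideanSpace ℝ (Fin 3)} (hty₀ : (t, y₀) ∈ W) :
    ∃ U : Set (EuclideanSpace ℝ (Fin 3)), IsOpen U ∧ y₀ ∈ U ∧ (∀ y ∈ U, (t, y) ∈ W) ∧
    ∃ P Λ c k pt : ℝ × ℝ → ℝ,
      (∀ y ∈ U, ContDiffAt ℝ n P (v t y 2, y 2) ∧ ContDiffAt ℝ n Λ (v t y 2, y 2) ∧ ContDiffAt ℝ n c (v t y 2, y 2) ∧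
        ContDiffAt ℝ n k (v t y 2, y 2) ∧ ContDiffAt ℝ n pt (v t y 2, y 2)) ∧
      (∀ y ∈ U, Λ (v t y 2, y 2) ≠ 0 ∧ Λ (v t y 2, y 2) ≠ 1) ∧
      (∀ y ∈ U, fderiv ℝ (fun x => v t x 2) y (EuclideanSpace.single 2 (1 : ℝ)) = P (v t y 2, y 2)) ∧
      (∀ y ∈ U, ∀ b : Fin 3, b ≠ 2 →
        fderiv ℝ (v t) y (EuclideanSpace.single 2 1) b = Λ (v t y 2, y 2) * fderiv ℝ (fun x => v t x 2) y (EuclideanSpace.single b (1 : ℝ))) ∧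
      (∀ y ∈ U,
        Λ (v t y 2, y 2) *
            (fderiv ℝ (fun y' => fderiv ℝ (fun x => v t x 2) y' (EuclideanSpace.single 0 (1 : ℝ))) y (EuclideanSpace.single 0 (1 : ℝ)) +
              fderiv ℝ (fun y' => fderiv ℝ (fun x => v t x 2) y' (EuclideanSpace.single 1 (1 : ℝ))) y (EuclideanSpace.single 1 (1 : ℝ))) +
          fderiv ℝ Λ (v t y 2, y 2) (1, 0) *
            (fderiv ℝ (fun x => v t x 2) y (EuclideanSpace.single 0 (1 : ℝ)) ^ 2 + fderiv ℝ (fun x => v t x 2) y (EuclideanSpace.single 1 (1 : ℝ)) ^ 2) +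
          c (v t y 2, y 2) = 0) ∧
      (∀ y ∈ U,
        (1 - Λ (v t y 2, y 2)) *
            (v t y 0 * fderiv ℝ (fun x => v t x 2) y (EuclideanSpace.single 0 (1 : ℝ)) +
              v t y 1 * fderiv ℝ (fun x => v t x 2) y (EuclideanSpace.single 1 (1 : ℝ)) + deriv (fun τ' => v τ' y 2) t) =
          (1 - Λ (v t y 2, y 2)) *
              (fderiv ℝ (fun y' => fderiv ℝ (fun x => v t x 2) y' (EuclideanSpace.single 0 (1 : ℝ))) y (EuclideanSpace.single 0 (1 : ℝ)) +
                fderiv ℝ (fun y' => fderiv ℝ (fun x => v t x 2) y' (EuclideanSpace.single 1 (1 : ℝ))) y (EuclideanSpace.single 1 (1 : ℝ))) -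
            fderiv ℝ Λ (v t y 2, y 2) (1, 0) *
              (fderiv ℝ (fun x => v t x 2) y (EuclideanSpace.single 0 (1 : ℝ)) ^ 2 + fderiv ℝ (fun x => v t x 2) y (EuclideanSpace.single 1 (1 : ℝ)) ^ 2) +
            k (v t y 2, y 2)) ∧
      (∀ y ∈ U,
        fderiv ℝ (fun y' => v t y' 0 * fderiv ℝ (fun x => v t x 2) y' (EuclideanSpace.single 0 (1 : ℝ)) +
            v t y' 1 * fderiv ℝ (fun x => v t x 2) y' (EuclideanSpace.single 1 (1 : ℝ)) + deriv (fun τ' => v τ' y' 2) t) y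
            (EuclideanSpace.single 2 (1 : ℝ)) =
          fderiv ℝ P (v t y 2, y 2) (1, 0) *
              (v t y 0 * fderiv ℝ (fun x => v t x 2) y (EuclideanSpace.single 0 (1 : ℝ)) +
                v t y 1 * fderiv ℝ (fun x => v t x 2) y (EuclideanSpace.single 1 (1 : ℝ)) + deriv (fun τ' => v τ' y 2) t) +
            Λ (v t y 2, y 2) *
              (fderiv ℝ (fun x => v t x 2) y (EuclideanSpace.single 0 (1 : ℝ)) ^ 2 + fderiv ℝ (fun x => v t x 2) y (EuclideanSpace.single 1 (1 : ℝ)) ^ 2) +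
            pt (v t y 2, y 2)) := by
  -- ## 0. the class data at `(t, y₀)`
  have ht : t < 0 := (mem_prod.1 (hWs hty₀)).1
  obtain ⟨-, hne, -⟩ := hND _ hty₀
  have hanV := analyticOnNhd_uncurry hcont (bdd_of_hasTypeITimeDecay hrate) hmild
  have hmem : ((t, y₀) : ℝ × EuclideanSpace ℝ (Fin 3)) ∈ Iio (0 : ℝ) ×ˢ (univ : Set (EuclideanSpace ℝ (Fin 3))) :=
    mk_mem_prod ht (mem_univ _)
  have hslab : Iio (0 : ℝ) ×ˢ (univ : Set (EuclideanSpace ℝ (Fin 3))) ∈ 𝓝 ((t, y₀) : ℝ × EuclideanSpace ℝ (Fin 3)) :=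
    (isOpen_Iio.prod isOpen_univ).mem_nhds hmem
  have hWn : W ∈ 𝓝 ((t, y₀) : ℝ × EuclideanSpace ℝ (Fin 3)) := hW.mem_nhds hty₀
  have hS : UniqueDiffOn ℝ (Iio (0 : ℝ)) := isOpen_Iio.uniqueDiffOn
  have hV : ContDiff ℝ ∞ (v t) := contDiff_slice hrate hcont hmild ht
  have hVd : Differentiable ℝ (v t) := hV.differentiable (by simp)
  set N : ℕ := n + 3 with hNdef
  have hN0 : ((N : ℕ∞) : WithTop ℕ∞) ≠ 0 := by simp [hNdef]
  have hNinf : ((N : ℕ∞) : WithTop ℕ∞) ≠ ∞ := by exact_mod_cast ENat.coe_ne_top N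
  -- ## 1. the Clebsch pair and the structure function `ψ = F̃(τ, v₂, y₂)`
  obtain ⟨φ, hφ⟩ : ∃ φ : ℝ → EuclideanSpace ℝ (Fin 3) → ℝ, φ = fun (t : ℝ) (x : EuclideanSpace ℝ (Fin 3)) =>
      ∫ σ in (0 : ℝ)..1, ⟪v t (σ • (x - x 2 • (EuclideanSpace.single (2 : Fin 3) (1 : ℝ))) +
        x 2 • (EuclideanSpace.single (2 : Fin 3) (1 : ℝ))), x - x 2 • (EuclideanSpace.single (2 : Fin 3) (1 : ℝ))⟫_ℝ := ⟨_, rfl⟩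
  obtain ⟨ψ, hψ⟩ : ∃ ψ : ℝ → EuclideanSpace ℝ (Fin 3) → ℝ, ψ = fun t y => v t y 2 - fderiv ℝ (φ t) y (EuclideanSpace.single 2 1) := ⟨_, rfl⟩
  obtain ⟨hφs, hψs, hslice⟩ := linePotential_pair_spec hrate hcont hmild hdiv hpol hφ hψ
  obtain ⟨hφsl, hψsl, hφ0, hφ1, hφ2, hcurl, -⟩ := hslice t ht
  have hψc : ContDiffAt ℝ ((N : ℕ∞) : WithTop ℕ∞) (uncurry ψ) (t, y₀) :=
    ((hψs (t, y₀) hmem).contDiffAt hslab).of_le (by exact_mod_cast le_top)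
  have hω : ∀ t < 0, ∀ y, curl (v t) y 0 = fderiv ℝ (ψ t) y (EuclideanSpace.single 1 1) ∧
      curl (v t) y 1 = -fderiv ℝ (ψ t) y (EuclideanSpace.single 0 1) := fun t' ht' y =>
    ⟨((hslice t' ht').2.2.2.2.2.1 y).1, ((hslice t' ht').2.2.2.2.2.1 y).2.1⟩
  obtain ⟨Fst, hFc, hFeq⟩ := exists_clebsch_eq_structureFunction hN0 hrate hcont hmild hdiv hpol ht hψc hω hne
  -- the vertical velocity as the leaf variable `g`
  have hgd : ∀ᶠ z in 𝓝 ((t, y₀) : ℝ × EuclideanSpace ℝ (Fin 3)), DifferentiableAt ℝ (uncurry fun t y => v t y 2) z := by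
    filter_upwards [hslab] with z hz
    have h1 : DifferentiableAt ℝ (uncurry v) z := (hanV z hz).differentiableAt
    exact ((EuclideanSpace.proj (𝕜 := ℝ) (2 : Fin 3)).differentiableAt).comp z h1
  have hgc : ContinuousAt (uncurry fun t y => v t y 2) (t, y₀) := (hgd.self_of_nhds).continuousAt
  have hDx := fderiv_slice_eq_of_eq_structureFunction (f := ψ) (g := fun t y => v t y 2) hN0 hgd hFc hgc hFeq
  have hDt := hasDerivAt_time_of_eq_structureFunction (f := ψ) (g := fun t y => v t y 2) hN0 hgd hFc hgc hFeq
  -- ## 2. the untwisted structure function `∂₂v₂ = P̃(τ, v₂, y₂)` (functional dependence in space–time)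
  set F₂ : ℝ → EuclideanSpace ℝ (Fin 3) → ℝ := fun τ y => fderiv ℝ (fun x => v τ x 2) y (EuclideanSpace.single 2 (1 : ℝ)) with hF₂
  have hF₂s : IsSmoothSpaceTimeOn (Iio (0 : ℝ)) F₂ :=
    (isSmoothSpaceTimeOn_vert hrate hcont hmild).fderiv_slice_apply hS (EuclideanSpace.single 2 (1 : ℝ))
  have hF₂c : ContDiffAt ℝ ((N : ℕ∞) : WithTop ℕ∞) (uncurry F₂) (t, y₀) :=
    ((hF₂s (t, y₀) hmem).contDiffAt hslab).of_le (by exact_mod_cast le_top)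
  have hg₂c : ContDiffAt ℝ ((N : ℕ∞) : WithTop ℕ∞) (fun z : ℝ × EuclideanSpace ℝ (Fin 3) => v z.1 z.2 2) (t, y₀) := by
    have h1 : ContDiffAt ℝ ((N : ℕ∞) : WithTop ℕ∞) (uncurry v) (t, y₀) := (hanV _ hmem).contDiffAt
    exact ((EuclideanSpace.proj (2 : Fin 3) : EuclideanSpace ℝ (Fin 3) →L[ℝ] ℝ).contDiff.contDiffAt).comp _ h1
  have hF₂d : ∀ᶠ z in 𝓝 ((t, y₀) : ℝ × EuclideanSpace ℝ (Fin 3)), DifferentiableAt ℝ (uncurry F₂) z ∧ z ∈ W := by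
    filter_upwards [hslab, hWn] with z hz hzW
    exact ⟨((hF₂s z hz).contDiffAt ((isOpen_Iio.prod isOpen_univ).mem_nhds hz)).differentiableAt (by simp), hzW⟩
  -- slice partials of `F₂` are the twist-bracket entries
  have hF₂x : ∀ z : ℝ × EuclideanSpace ℝ (Fin 3), DifferentiableAt ℝ (uncurry F₂) z → z ∈ W → ∀ b : Fin 3,
      fderiv ℝ (uncurry F₂) z ((0 : ℝ), EuclideanSpace.single b (1 : ℝ)) =
        fderiv ℝ (fun x => fderiv ℝ (v z.1) x (EuclideanSpace.single 2 1) 2) z.2 (EuclideanSpace.single b 1) := by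
    intro z hz hzW b
    obtain ⟨τ, y⟩ := z
    have hτ : τ < 0 := (mem_prod.1 (hWs hzW)).1
    have hVτ : Differentiable ℝ (v τ) := (contDiff_slice hrate hcont hmild hτ).differentiable (by simp)
    rw [fderiv_uncurry_zero_dir hz]
    have e : F₂ τ = fun x => fderiv ℝ (v τ) x (EuclideanSpace.single 2 1) 2 := by
      funext x; rw [hF₂]; exact fderiv_coord_apply (hVτ x) 2 _
    rw [e]
  obtain ⟨b₀, b₁, hb₀, hb₁, hb, hpin0, hsgn⟩ : ∃ b₀ b₁ : Fin 3, b₀ ≠ 2 ∧ b₁ ≠ 2 ∧ b₀ ≠ b₁ ∧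
      fderiv ℝ (v t) y₀ (EuclideanSpace.single b₀ 1) 2 ≠ 0 ∧
      ∀ z ∈ W, fderiv ℝ (fun x => fderiv ℝ (v z.1) x (EuclideanSpace.single 2 1) 2) z.2 (EuclideanSpace.single b₀ 1) *
          fderiv ℝ (v z.1) z.2 (EuclideanSpace.single b₁ 1) 2 =
        fderiv ℝ (fun x => fderiv ℝ (v z.1) x (EuclideanSpace.single 2 1) 2) z.2 (EuclideanSpace.single b₁ 1) *
          fderiv ℝ (v z.1) z.2 (EuclideanSpace.single b₀ 1) 2 := by
    rcases hne with h0 | h1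
    · exact ⟨0, 1, by decide, by decide, by decide, h0, fun z hz => by linear_combination htw z hz⟩
    · exact ⟨1, 0, by decide, by decide, by decide, h1, fun z hz => by linear_combination -(htw z hz)⟩
  have hpin : fderiv ℝ (fun z : ℝ × EuclideanSpace ℝ (Fin 3) => v z.1 z.2 2) (t, y₀) ((0 : ℝ), EuclideanSpace.single b₀ (1 : ℝ)) ≠ 0 := by
    rw [fderiv_uncurry_apply_two_zero_dir (hanV _ hmem).differentiableAt]
    exact hpin0
  have hbr : ∀ᶠ z in 𝓝 ((t, y₀) : ℝ × EuclideanSpace ℝ (Fin 3)),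
      fderiv ℝ (uncurry F₂) z ((0 : ℝ), EuclideanSpace.single b₀ (1 : ℝ)) *
          fderiv ℝ (fun z : ℝ × EuclideanSpace ℝ (Fin 3) => v z.1 z.2 2) z ((0 : ℝ), EuclideanSpace.single b₁ (1 : ℝ)) =
        fderiv ℝ (uncurry F₂) z ((0 : ℝ), EuclideanSpace.single b₁ (1 : ℝ)) *
          fderiv ℝ (fun z : ℝ × EuclideanSpace ℝ (Fin 3) => v z.1 z.2 2) z ((0 : ℝ), EuclideanSpace.single b₀ (1 : ℝ)) := by
    filter_upwards [hF₂d, hslab] with z hz hzs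
    obtain ⟨hzd, hzW⟩ := hz
    have hvz : DifferentiableAt ℝ (uncurry v) z := (hanV z hzs).differentiableAt
    obtain ⟨τ, y⟩ := z
    rw [hF₂x _ hzd hzW b₀, hF₂x _ hzd hzW b₁, fderiv_uncurry_apply_two_zero_dir hvz, fderiv_uncurry_apply_two_zero_dir hvz]
    exact hsgn _ hzW
  obtain ⟨Pst, hPc, hPeq⟩ := exists_comp_spaceTime hN0 hb₀ hb₁ hb hF₂c hg₂c hpin hbr
  have hPeq' : ∀ᶠ z in 𝓝 ((t, y₀) : ℝ × EuclideanSpace ℝ (Fin 3)), F₂ z.1 z.2 = Pst (z.1, v z.1 z.2 2, z.2 2) :=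
    hPeq.mono fun z hz => hz
  have hDtP := hasDerivAt_time_of_eq_structureFunction (f := F₂) (g := fun t y => v t y 2) hN0 hgd hPc hgc hPeq'
  -- ## 3. the leafwise dynamic scalar `T = τ(v₂, y₂)`
  obtain ⟨τ, hτc, hτeq⟩ := exists_dynScalar_eq_leafwise (n := (N : ℕ∞)) (by simp [hNdef]) hrate hcont hmild hdiv hpol hφ hψ ht
    (y₀ := y₀) hne
  -- ## 4. everything holds on a spatial neighbourhood of `y₀` in the slice `t`
  have hι : Tendsto (fun y : EuclideanSpace ℝ (Fin 3) => ((t, y) : ℝ × EuclideanSpace ℝ (Fin 3))) (𝓝 y₀) (𝓝 (t, y₀)) :=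
    (continuousAt_const.prodMk continuousAt_id).tendsto
  have hL3 : Tendsto (fun y : EuclideanSpace ℝ (Fin 3) => ((t, v t y 2, y 2) : ℝ × ℝ × ℝ)) (𝓝 y₀) (𝓝 (t, v t y₀ 2, y₀ 2)) := by
    have h1 : ContinuousAt (fun y : EuclideanSpace ℝ (Fin 3) => v t y 2) y₀ :=
      ((EuclideanSpace.proj (𝕜 := ℝ) (2 : Fin 3)).continuous.continuousAt).comp (hVd y₀).continuousAt
    have h2 : ContinuousAt (fun y : EuclideanSpace ℝ (Fin 3) => y 2) y₀ := (EuclideanSpace.proj (𝕜 := ℝ) (2 : Fin 3)).continuous.continuousAt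
    exact (continuousAt_const.prodMk (h1.prodMk h2)).tendsto
  have hL2 : Tendsto (fun y : EuclideanSpace ℝ (Fin 3) => ((v t y 2, y 2) : ℝ × ℝ)) (𝓝 y₀) (𝓝 (v t y₀ 2, y₀ 2)) := by
    have h1 : ContinuousAt (fun y : EuclideanSpace ℝ (Fin 3) => v t y 2) y₀ :=
      ((EuclideanSpace.proj (𝕜 := ℝ) (2 : Fin 3)).continuous.continuousAt).comp (hVd y₀).continuousAt
    exact (continuousAt_leafMap h1).tendsto
  have hall : ∀ᶠ y in 𝓝 y₀, (t, y) ∈ W ∧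
      ContDiffAt ℝ ((N : ℕ∞) : WithTop ℕ∞) Fst (t, v t y 2, y 2) ∧ ContDiffAt ℝ ((N : ℕ∞) : WithTop ℕ∞) Pst (t, v t y 2, y 2) ∧
      ContDiffAt ℝ ((N : ℕ∞) : WithTop ℕ∞) τ (v t y 2, y 2) ∧
      ψ t y = Fst (t, v t y 2, y 2) ∧
      (∀ e : EuclideanSpace ℝ (Fin 3), fderiv ℝ (ψ t) y e =
        fderiv ℝ Fst (t, v t y 2, y 2) ((0 : ℝ), (1 : ℝ), (0 : ℝ)) * fderiv ℝ (fun x => v t x 2) y e +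
          e 2 * fderiv ℝ Fst (t, v t y 2, y 2) ((0 : ℝ), (0 : ℝ), (1 : ℝ))) ∧
      HasDerivAt (fun τ' => ψ τ' y) (fderiv ℝ Fst (t, v t y 2, y 2) ((1 : ℝ), (0 : ℝ), (0 : ℝ)) +
        fderiv ℝ Fst (t, v t y 2, y 2) ((0 : ℝ), (1 : ℝ), (0 : ℝ)) * deriv (fun τ' => v τ' y 2) t) t ∧
      F₂ t y = Pst (t, v t y 2, y 2) ∧
      HasDerivAt (fun τ' => F₂ τ' y) (fderiv ℝ Pst (t, v t y 2, y 2) ((1 : ℝ), (0 : ℝ), (0 : ℝ)) +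
        fderiv ℝ Pst (t, v t y 2, y 2) ((0 : ℝ), (1 : ℝ), (0 : ℝ)) * deriv (fun τ' => v τ' y 2) t) t ∧
      deriv (fun s => ψ s y) t + (convect (v t) (ψ t) y - Δ (ψ t) y) = τ (v t y 2, y 2) := by
    filter_upwards [hι.eventually hWn, hL3.eventually (hFc.eventually hNinf), hL3.eventually (hPc.eventually hNinf),
      hL2.eventually (hτc.eventually hNinf), hι.eventually hFeq, hι.eventually hDx, hι.eventually hDt, hι.eventually hPeq',
      hι.eventually hDtP, hτeq] with y h1 h2 h3 h4 h5 h6 h7 h8 h9 h10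
    exact ⟨h1, h2, h3, h4, h5, h6, h7, h8, h9, h10⟩
  obtain ⟨U, hU, hUo, hy₀U⟩ := _root_.eventually_nhds_iff.1 hall
  -- ## 5. the slice structure functions
  set F : ℝ × ℝ → ℝ := fun q => Fst (t, q.1, q.2) with hFdef
  set P : ℝ × ℝ → ℝ := fun q => Pst (t, q.1, q.2) with hPdef
  set Λ : ℝ × ℝ → ℝ := fun q => 1 - fderiv ℝ F q (1, 0) with hΛdef
  set c : ℝ × ℝ → ℝ := fun q => fderiv ℝ P q (P q, 1) with hcdef
  set pt : ℝ × ℝ → ℝ := fun q => fderiv ℝ Pst (t, q.1, q.2) ((1 : ℝ), (0 : ℝ), (0 : ℝ)) with hptdef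
  set k : ℝ × ℝ → ℝ := fun q => τ q - fderiv ℝ Fst (t, q.1, q.2) ((1 : ℝ), (0 : ℝ), (0 : ℝ)) -
      fderiv ℝ F q (1, 0) * (q.1 * P q) - q.1 * fderiv ℝ F q (0, 1) + fderiv ℝ F q (1, 0) * fderiv ℝ P q (P q, 1) +
      fderiv ℝ (fun r => fderiv ℝ F r ((1 : ℝ), (0 : ℝ))) q (1, 0) * P q ^ 2 +
      (fderiv ℝ (fun r => fderiv ℝ F r ((1 : ℝ), (0 : ℝ))) q (0, 1) + fderiv ℝ (fun r => fderiv ℝ F r ((0 : ℝ), (1 : ℝ))) q (1, 0)) * P q +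
      fderiv ℝ (fun r => fderiv ℝ F r ((0 : ℝ), (1 : ℝ))) q (0, 1) with hkdef
  -- regularity of the slices at the leaf points of `U`
  have hFN : ∀ y ∈ U, ContDiffAt ℝ ((N : ℕ∞) : WithTop ℕ∞) F (v t y 2, y 2) := fun y hy => contDiffAt_timeSlice (hU y hy).2.1
  have hPN : ∀ y ∈ U, ContDiffAt ℝ ((N : ℕ∞) : WithTop ℕ∞) P (v t y 2, y 2) := fun y hy => contDiffAt_timeSlice (hU y hy).2.2.1
  have hN2 : (2 : WithTop ℕ∞) ≤ ((N : ℕ∞) : WithTop ℕ∞) := by rw [WithTop.coe_natCast]; norm_cast; omega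
  have hF2 : ∀ y ∈ U, ContDiffAt ℝ 2 F (v t y 2, y 2) := fun y hy => (hFN y hy).of_le hN2
  have hPd : ∀ y ∈ U, DifferentiableAt ℝ P (v t y 2, y 2) := fun y hy => (hPN y hy).differentiableAt (by simp [hNdef])
  have hFstd : ∀ y ∈ U, DifferentiableAt ℝ Fst (t, v t y 2, y 2) := fun y hy => (hU y hy).2.1.differentiableAt (by simp [hNdef])
  have hPstd : ∀ y ∈ U, DifferentiableAt ℝ Pst (t, v t y 2, y 2) := fun y hy => (hU y hy).2.2.1.differentiableAt (by simp [hNdef])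
  -- `F̃_q = F_w`, `F̃_z = F_z`, `P̃_q = P_w` at the leaf points
  have hFw : ∀ y ∈ U, fderiv ℝ Fst (t, v t y 2, y 2) ((0 : ℝ), (1 : ℝ), (0 : ℝ)) = fderiv ℝ F (v t y 2, y 2) (1, 0) := fun y hy => by
    rw [hFdef, fderiv_timeSlice_apply (p := (v t y 2, y 2)) (hFstd y hy)]
  have hFz : ∀ y ∈ U, fderiv ℝ Fst (t, v t y 2, y 2) ((0 : ℝ), (0 : ℝ), (1 : ℝ)) = fderiv ℝ F (v t y 2, y 2) (0, 1) := fun y hy => by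
    rw [hFdef, fderiv_timeSlice_apply (p := (v t y 2, y 2)) (hFstd y hy)]
  have hPw : ∀ y ∈ U, fderiv ℝ Pst (t, v t y 2, y 2) ((0 : ℝ), (1 : ℝ), (0 : ℝ)) = fderiv ℝ P (v t y 2, y 2) (1, 0) := fun y hy => by
    rw [hPdef, fderiv_timeSlice_apply (p := (v t y 2, y 2)) (hPstd y hy)]
  -- the two first-order identities on `U`
  have hP' : ∀ y ∈ U, fderiv ℝ (fun x => v t x 2) y (EuclideanSpace.single 2 (1 : ℝ)) = P (v t y 2, y 2) := fun y hy =>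
    (hU y hy).2.2.2.2.2.2.2.1
  have hDx' : ∀ y ∈ U, ∀ e : EuclideanSpace ℝ (Fin 3), fderiv ℝ (ψ t) y e =
      fderiv ℝ F (v t y 2, y 2) (1, 0) * fderiv ℝ (fun x => v t x 2) y e + e 2 * fderiv ℝ F (v t y 2, y 2) (0, 1) := by
    intro y hy e
    rw [(hU y hy).2.2.2.2.2.1 e, hFw y hy, hFz y hy]
  have hΛ' : ∀ y ∈ U, ∀ b : Fin 3, b ≠ 2 →
      fderiv ℝ (v t) y (EuclideanSpace.single 2 1) b = Λ (v t y 2, y 2) * fderiv ℝ (fun x => v t x 2) y (EuclideanSpace.single b (1 : ℝ)) := by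
    intro y hy b hb
    exact shear_eq_slope_mul (hφsl.of_le (by norm_cast)) (hψsl.differentiable (by simp)) hVd hφ0 hφ1 hφ2 (hDx' y hy) hb
  refine ⟨U, hUo, hy₀U, fun y hy => (hU y hy).1, P, Λ, c, k, pt, ?_, ?_, hP', hΛ', ?_, ?_, ?_⟩
  · -- ## regularity (`N = n + 3` derivatives of the structure functions are available)
    intro y hy
    have hτN : ContDiffAt ℝ ((N : ℕ∞) : WithTop ℕ∞) τ (v t y 2, y 2) := (hU y hy).2.2.2.1
    have hFstN : ContDiffAt ℝ ((N : ℕ∞) : WithTop ℕ∞) Fst (t, v t y 2, y 2) := (hU y hy).2.1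
    have hPstN : ContDiffAt ℝ ((N : ℕ∞) : WithTop ℕ∞) Pst (t, v t y 2, y 2) := (hU y hy).2.2.1
    have e3 : (((n + 2) + 1 : ℕ) : WithTop ℕ∞) ≤ ((N : ℕ∞) : WithTop ℕ∞) := by rw [WithTop.coe_natCast]
    have en : ((n : ℕ) : WithTop ℕ∞) ≤ ((N : ℕ∞) : WithTop ℕ∞) := by rw [WithTop.coe_natCast]; exact_mod_cast (by omega : n ≤ N)
    have en1 : ((n : ℕ) : WithTop ℕ∞) ≤ ((n + 1 : ℕ) : WithTop ℕ∞) := by exact_mod_cast Nat.le_succ n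
    have en2 : ((n : ℕ) : WithTop ℕ∞) ≤ ((n + 2 : ℕ) : WithTop ℕ∞) := by exact_mod_cast (by omega : n ≤ n + 2)
    have hF3 : ContDiffAt ℝ (((n + 2) + 1 : ℕ) : WithTop ℕ∞) F (v t y 2, y 2) := (hFN y hy).of_le e3
    have hP3 : ContDiffAt ℝ (((n + 2) + 1 : ℕ) : WithTop ℕ∞) P (v t y 2, y 2) := (hPN y hy).of_le e3
    -- first and second partials of the slices
    have hFw : ContDiffAt ℝ ((n + 2 : ℕ) : WithTop ℕ∞) (fun q => fderiv ℝ F q ((1 : ℝ), (0 : ℝ))) (v t y 2, y 2) :=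
      contDiffAt_dirPartial hF3 _
    have hFz : ContDiffAt ℝ ((n + 2 : ℕ) : WithTop ℕ∞) (fun q => fderiv ℝ F q ((0 : ℝ), (1 : ℝ))) (v t y 2, y 2) :=
      contDiffAt_dirPartial hF3 _
    have hFww := contDiffAt_dirPartial (m := n + 1) hFw ((1 : ℝ), (0 : ℝ))
    have hFwz := contDiffAt_dirPartial (m := n + 1) hFw ((0 : ℝ), (1 : ℝ))
    have hFzw := contDiffAt_dirPartial (m := n + 1) hFz ((1 : ℝ), (0 : ℝ))
    have hFzz := contDiffAt_dirPartial (m := n + 1) hFz ((0 : ℝ), (1 : ℝ))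
    have hPdot : ContDiffAt ℝ ((n + 2 : ℕ) : WithTop ℕ∞) (fun q => fderiv ℝ P q (P q, 1)) (v t y 2, y 2) := contDiffAt_dotPartial hP3
    -- the time partials, sliced
    have hFt : ContDiffAt ℝ ((n + 2 : ℕ) : WithTop ℕ∞) (fun q : ℝ × ℝ => fderiv ℝ Fst (t, q.1, q.2) ((1 : ℝ), (0 : ℝ), (0 : ℝ))) (v t y 2, y 2) := by
      have h1 : ContDiffAt ℝ ((n + 2 : ℕ) : WithTop ℕ∞) (fderiv ℝ Fst) (t, v t y 2, y 2) :=
        (hFstN.of_le e3).fderiv_right (m := ((n + 2 : ℕ) : WithTop ℕ∞)) (by norm_cast)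
      exact contDiffAt_timeSlice (G := fun r => fderiv ℝ Fst r ((1 : ℝ), (0 : ℝ), (0 : ℝ))) (h1.clm_apply contDiffAt_const)
    have hPt : ContDiffAt ℝ ((n + 2 : ℕ) : WithTop ℕ∞) (fun q : ℝ × ℝ => fderiv ℝ Pst (t, q.1, q.2) ((1 : ℝ), (0 : ℝ), (0 : ℝ))) (v t y 2, y 2) := by
      have h1 : ContDiffAt ℝ ((n + 2 : ℕ) : WithTop ℕ∞) (fderiv ℝ Pst) (t, v t y 2, y 2) :=
        (hPstN.of_le e3).fderiv_right (m := ((n + 2 : ℕ) : WithTop ℕ∞)) (by norm_cast)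
      exact contDiffAt_timeSlice (G := fun r => fderiv ℝ Pst r ((1 : ℝ), (0 : ℝ), (0 : ℝ))) (h1.clm_apply contDiffAt_const)
    -- everything at order `n`
    have hPn : ContDiffAt ℝ ((n : ℕ) : WithTop ℕ∞) P (v t y 2, y 2) := (hPN y hy).of_le en
    have hτn : ContDiffAt ℝ ((n : ℕ) : WithTop ℕ∞) τ (v t y 2, y 2) := hτN.of_le en
    have h1n : ContDiffAt ℝ ((n : ℕ) : WithTop ℕ∞) (fun q : ℝ × ℝ => q.1) (v t y 2, y 2) := contDiffAt_fst
    refine ⟨hPn, contDiffAt_const.sub (hFw.of_le en2), hPdot.of_le en2, ?_, hPt.of_le en2⟩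
    exact ((((((hτn.sub (hFt.of_le en2)).sub ((hFw.of_le en2).mul (h1n.mul hPn))).sub (h1n.mul (hFz.of_le en2))).add
      ((hFw.of_le en2).mul (hPdot.of_le en2))).add ((hFww.of_le en1).mul (hPn.pow 2))).add
      (((hFwz.of_le en1).add (hFzw.of_le en1)).mul hPn)).add (hFzz.of_le en1)
  · -- ## the pins `Λ ≠ 0` (from `∂₂vₕ ≠ 0`) and `Λ ≠ 1` (from `curl v ≠ 0`)
    intro y hy
    obtain ⟨hcurl_ne, -, hpin2⟩ := hND _ (hU y hy).1
    have hpin2' : fderiv ℝ (v t) y (EuclideanSpace.single 2 1) 0 ≠ 0 ∨ fderiv ℝ (v t) y (EuclideanSpace.single 2 1) 1 ≠ 0 := hpin2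
    have hΛy := hΛ' y hy
    refine ⟨fun h0 => ?_, fun h1 => hcurl_ne ?_⟩
    · rcases hpin2' with h | h
      · exact h (by rw [hΛy 0 (by decide), h0, zero_mul])
      · exact h (by rw [hΛy 1 (by decide), h0, zero_mul])
    · obtain ⟨hc0, hc1, hc2⟩ := hcurl y
      have hFw1 : fderiv ℝ F (v t y 2, y 2) (1, 0) = 0 := by
        have h1' : 1 - fderiv ℝ F (v t y 2, y 2) (1, 0) = 1 := h1
        linarith
      have h0' : curl (v t) y 0 = 0 := by rw [hc0, hDx' y hy]; simp [hFw1]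
      have h1' : curl (v t) y 1 = 0 := by rw [hc1, hDx' y hy]; simp [hFw1]
      ext i
      fin_cases i
      · simpa using h0'
      · simpa using h1'
      · simpa using hc2
  · -- ## (K1)
    intro y hy
    have hΛd : ∀ y ∈ U, DifferentiableAt ℝ Λ (v t y 2, y 2) := fun y hy =>
      ((differentiableAt_const _).sub (differentiableAt_dirPartial (hF2 y hy) _))
    exact divIdentity_of_structureFunctions (V := v t) (hV.of_le (by norm_cast)) (hdiv t ht) hUo hPd hΛd hP' hΛ' hy
  · -- ## (V0)
    intro y hy
    have hDt' : HasDerivAt (fun τ' => ψ τ' y) (fderiv ℝ Fst (t, v t y 2, y 2) ((1 : ℝ), (0 : ℝ), (0 : ℝ)) +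
        fderiv ℝ F (v t y 2, y 2) (1, 0) * deriv (fun τ' => v τ' y 2) t) t := by
      rw [← hFw y hy]; exact (hU y hy).2.2.2.2.2.2.1
    have h := dynIdentity hrate hcont hmild hdiv hpol hφ hψ ht hUo (F := F) (P := P) (τ := τ) (Λ := Λ)
      (fun y' hy' => (hU y' hy').2.2.2.2.1) hF2 hPd hP' rfl hy hDt' (hDx' y hy) (hU y hy).2.2.2.2.2.2.2.2.2
    exact h
  · -- ## (Sz)
    intro y hy
    have hDt' : HasDerivAt (fun τ' => fderiv ℝ (fun x => v τ' x 2) y (EuclideanSpace.single 2 (1 : ℝ)))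
        (pt (v t y 2, y 2) + fderiv ℝ P (v t y 2, y 2) (1, 0) * deriv (fun τ' => v τ' y 2) t) t := by
      rw [← hPw y hy]; exact (hU y hy).2.2.2.2.2.2.2.2.1
    exact transport_rule hrate hcont hmild ht hUo hPd hP' hΛ' hy hDt'
end Profile

end Summit.NavierStokesRegularity.NavierStokesRegularity.Theorems.PoloidalWindowDoorPoloidalWindowRigidityUntwistedDynamics

end
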